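import Literature.AnabelianGeometry.SemiGraphs.WitnessIwahoriBundle
import Literature.AnabelianGeometry.SemiGraphs.TemperedReconstructionReductions
import Literature.AnabelianGeometry.SemiGraphs.TemperedFunctorialityWithHom
import Literature.AnabelianGeometry.SemiGraphs.TemperedPiChartExists
import Mathlib.NumberTheory.Padics.RingHoms
import HarnessLib

/-!
# The chosen-conjugator reading of [SemiAnbd] Cor. 3.9, step (R3), is refutable: a kernel witness

Mochizuki, *Semi-graphs of anabelioids*, Publ. RIMS **42** (2006), §3, Cor. 3.9 p. 42 and its proof
p. 43, with Rmk. 2.4.2 p. 26 (a morphism of semi-graphs of anabelioids is compatible with the branch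
maps only "up to conjugation": the 2-cells are data). [cite: MochizukiSemiAnbd2006, Cor 3.9 pp.42-43]

The tree's step (R3) of the printed proof, `ProfiniteSemiGraph.InducesOfCompatible`
(`TemperedReconstructionReductions.lean`), concludes `F.Induces c𝒢 cℋ φ`, i.e. that `B^temp(φ)` is
isomorphic to the pull-back functor of `F` glued along the CHOSEN conjugating elements
(`Hom.chosenConjugators`, `Classical.choose`). This file proves that this reading is FALSE
(`ProfiniteSemiGraph.not_inducesOfCompatible`, via `IwahoriWitness.false_of_inducesOfCompatible` for
every prime `p`), on the landed witness object `IwahoriWitness.loopGraph p`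
(one vertex with group `P = ℤ_p ⋊ (1 + pℤ_p)`, one estranged loop with group `U = 1 + pℤ_p`,
`WitnessIwahoriLoop/Bundle.lean`) and its identity morphism `loopGraphId p`:

* for every `κ ∈ U` the family of conjugating elements `twistFamily κ` of `loopGraphId p` — `b₀(κ)` at
  the torus branch, `1` at the twisted branch — is admissible (`U` is commutative);
* by `Hom.exists_inducedHom_with` (Prop. 3.2, unconditional) each pull-back `F^*_{θ_κ}` through a chart
  is `B^temp(φ_κ)` for a continuous `φ_κ` which is compatible with `F` on verticial AND edge
  homomorphisms (`conj_of_chartPullbackWith_iso(_edge)`); so `InducesOfCompatible` would make every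
  `F^*_{θ_κ}` isomorphic to the chosen pull-back, hence `F^*_{θ_1} S ≅ F^*_{θ_κ} S` for every tempered `S`;
* but for the explicit finite tempered covering `twistCov p` (vertex fibre the translation `P`-set
  `(ℤ/p)²`, edge fibre its restriction along the torus branch, glued along `b_c` by the shear
  `(x, y) ↦ (x + c̄y, y)`) there is NO morphism `F^*_{θ_κ} S → F^*_{θ_κ'} S` at all unless
  `κ ≡ κ' (mod p)` (`toZMod_eq_of_hom`: compare the two gluing squares at the point `0`).

Faithful reading that survives (landed): `Hom.InducesUpToTwist` / `Cor39CompatUpToTwist`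
(`TemperedReconstructionCor39UpToTwist.lean`), where the family of conjugating elements is
existentially quantified. Nothing here takes a side on [IUTchIII] Cor. 3.12.
-/

noncomputable section

open CategoryTheory Topology
open scoped Pointwise

namespace Literature.AnabelianGeometry.SemiGraphs

namespace IwahoriWitness

open ProfiniteSemiGraph
open Literature.AlgebraicGeometry.Frobenioids.QuasiTemperoid (BTempConnected.hom_ρ)

universe u

variable (p : ℕ) [Fact p.Prime]

/-! ## 1. Residues modulo `p` of the two coordinates of `P` -/

/-- The residues `(ā, s̄) ∈ (ℤ/p)²` of `(a, s) ∈ P`: a homomorphism to the additive group `(ℤ/p)²`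
(modulo `p` the unit `1 + ps` acts trivially). [cite: MochizukiSemiAnbd2006, §2 p.23] -/
def resHom : Iw p →* Multiplicative (ZMod p × ZMod p) where
  toFun g := Multiplicative.ofAdd (PadicInt.toZMod g.a, PadicInt.toZMod g.s)
  map_one' := by simp
  map_mul' g h := by
    rw [← ofAdd_add]
    congr 1
    have hp : PadicInt.toZMod (p : ℤ_[p]) = 0 := by rw [map_natCast, ZMod.natCast_self]
    ext
    · simp only [Iw.mul_a, IwahoriWitness.w, map_add, map_mul, map_one, hp, zero_mul, add_zero,
        one_mul, Prod.fst_add]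
    · simp only [Iw.mul_s, map_add, map_mul, hp, zero_mul, add_zero, Prod.snd_add]

/-- `resHom` on elements. [cite: MochizukiSemiAnbd2006, §2 p.23] -/
@[simp] theorem toAdd_resHom (g : Iw p) :
    (resHom p g).toAdd = (PadicInt.toZMod g.a, PadicInt.toZMod g.s) := rfl

/-- The kernel of `resHom` (the level-`1` box) is open. [cite: MochizukiSemiAnbd2006, §2 p.23] -/
theorem isOpen_ker_resHom : IsOpen ((resHom p).ker : Set (Iw p)) := by
  -- `ℤ_p → ℤ/p` vanishes exactly on the open unit ball (`Literature.MeasureTheory.Group.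
  -- padicInt_toZMod_eq_zero_iff`, restated inline to keep the import list inside §3)
  have hopen : IsOpen {x : ℤ_[p] | PadicInt.toZMod x = 0} := by
    have : {x : ℤ_[p] | PadicInt.toZMod x = 0} = {x | ‖x‖ < 1} := by
      ext x
      simp only [Set.mem_setOf_eq]
      rw [← RingHom.mem_ker, PadicInt.ker_toZMod, IsLocalRing.mem_maximalIdeal, PadicInt.mem_nonunits]
    rw [this]
    exact isOpen_lt continuous_norm continuous_const
  have h : ((resHom p).ker : Set (Iw p)) =
      (fun g : Iw p => g.a) ⁻¹' {x | PadicInt.toZMod x = 0} ∩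
        (fun g : Iw p => g.s) ⁻¹' {x | PadicInt.toZMod x = 0} := by
    ext g
    simp only [SetLike.mem_coe, MonoidHom.mem_ker, Set.mem_inter_iff, Set.mem_preimage,
      Set.mem_setOf_eq]
    constructor
    · intro hg
      have h' := congrArg Multiplicative.toAdd hg
      rw [toAdd_resHom, toAdd_one, Prod.mk_eq_zero] at h'
      exact h'
    · rintro ⟨ha, hs⟩
      apply Multiplicative.toAdd.injective
      rw [toAdd_resHom, toAdd_one, Prod.mk_eq_zero]
      exact ⟨ha, hs⟩
  rw [h]
  exact (hopen.preimage Iw.continuous_a).inter (hopen.preimage Iw.continuous_s)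

/-- A homomorphism with open kernel to a discrete group pulls every subset back to an open set.
[cite: MochizukiSemiAnbd2006, §3 p.33] -/
private theorem isOpen_preimage_of_isOpen_ker {G F : Type*} [Group G] [TopologicalSpace G]
    [IsTopologicalGroup G] [Group F] (π : G →* F) (hπ : IsOpen (π.ker : Set G)) (S : Set F) :
    IsOpen (π ⁻¹' S) := by
  have : π ⁻¹' S = (π ⁻¹' S) * (π.ker : Set G) := by
    ext x
    constructor
    · intro hx
      exact ⟨x, hx, 1, π.ker.one_mem, mul_one x⟩
    · rintro ⟨a, ha, k, hk, rfl⟩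
      simp only [Set.mem_preimage, map_mul, (MonoidHom.mem_ker).mp hk, mul_one]
      exact ha
  rw [this]
  exact hπ.mul_left

/-! ## 2. The finite tempered covering `S` of `𝒢₁` -/

/-- The vertex fibre: `(ℤ/p)²` with `P` acting by translation through the residues `(ā, s̄)` (a
finite `P`-set with open stabilisers). [cite: MochizukiSemiAnbd2006, §3 p.36] -/
def translObj : BTemp (Iw p) :=
  ⟨@Action.ofMulAction (Iw p) (ZMod p × ZMod p) _ (MulAction.compHom (ZMod p × ZMod p) (resHom p)), by
    refine ⟨inferInstanceAs (Countable (ZMod p × ZMod p)), fun x => ?_⟩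
    change ZMod p × ZMod p at x
    have : {γ : Iw p | (@Action.ofMulAction (Iw p) (ZMod p × ZMod p) _
        (MulAction.compHom (ZMod p × ZMod p) (resHom p))).ρ γ x = x} =
        resHom p ⁻¹' {m : Multiplicative (ZMod p × ZMod p) | m.toAdd + x = x} := by
      ext γ
      rfl
    rw [this]
    exact isOpen_preimage_of_isOpen_ker (resHom p) (isOpen_ker_resHom p) _⟩

/-- The action on the vertex fibre is translation by the residues. [cite: MochizukiSemiAnbd2006, §3 p.36] -/
theorem translObj_ρ (g : Iw p) (x : ZMod p × ZMod p) :
    (translObj p).obj.ρ g x = (PadicInt.toZMod g.a, PadicInt.toZMod g.s) + x := rfl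

/-- The shear `(x, y) ↦ (x + c y, y)` of `(ℤ/p)²`. [cite: MochizukiSemiAnbd2006, §3 p.36] -/
def shearEquiv (c : ZMod p) : ZMod p × ZMod p ≃ ZMod p × ZMod p where
  toFun x := (x.1 + c * x.2, x.2)
  invFun x := (x.1 - c * x.2, x.2)
  left_inv x := by simp
  right_inv x := by simp

/-- The shear by `c̄` is a `U`-isomorphism from the restriction of the vertex fibre along the torus
branch `b₀` to its restriction along `b_c` (`b_c(s) = (cs, s)` acts by `(c̄s̄, s̄)`): the gluing of `S`
along the branch with coefficient `c`. [cite: MochizukiSemiAnbd2006, §3 p.36] -/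
def shearIso (c : ℤ_[p]) :
    (BTemp.res (Iw.bHom 0)).obj (translObj p) ≅ (BTemp.res (Iw.bHom c)).obj (translObj p) :=
  BTemp.isoOfEquiv (shearEquiv p (PadicInt.toZMod c)) fun u x => by
    change shearEquiv p (PadicInt.toZMod c) ((translObj p).obj.ρ (Iw.bHom 0 u) x) =
      (translObj p).obj.ρ (Iw.bHom c u) (shearEquiv p (PadicInt.toZMod c) x)
    change ZMod p × ZMod p at x
    rw [translObj_ρ, translObj_ρ]
    simp only [Iw.bHom_a, Iw.bHom_s, zero_mul, map_zero, map_mul]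
    refine Prod.ext ?_ ?_
    · simp only [shearEquiv, Equiv.coe_fn_mk, Prod.fst_add, Prod.snd_add]
      ring
    · simp only [shearEquiv, Equiv.coe_fn_mk, Prod.snd_add]

/-- **The covering `S` of `𝒢₁`**: vertex fibre the translation object, edge fibre its restriction
along `b₀`, glued along the branch with coefficient `c ∈ {0, 1}` by the shear by `c̄`.
[cite: MochizukiSemiAnbd2006, §3 p.36] -/
def twistCov : CovObj (loopGraph p) where
  SV _ := translObj p
  SE _ := (BTemp.res (Iw.bHom 0)).obj (translObj p)
  glue b _ _ := shearIso p (coeff p b)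

/-- Underlying map of the gluing of `S` along `b`: the shear by the coefficient of `b`.
[cite: MochizukiSemiAnbd2006, §3 p.36] -/
theorem twistCov_glue_apply (b : (SemiGraph.bouquet.{0} 1).Branch)
    (v : (SemiGraph.bouquet.{0} 1).Vertex) (h : (SemiGraph.bouquet.{0} 1).abuts b = some v)
    (x : ZMod p × ZMod p) :
    ((twistCov p).glue b v h).hom.hom.hom x = shearEquiv p (PadicInt.toZMod (coeff p b)) x := rfl

/-- `S` is finite. [cite: MochizukiSemiAnbd2006, §3 p.37] -/
theorem twistCov_isFinite : (twistCov p).IsFinite :=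
  ⟨fun _ => inferInstanceAs (Finite (ZMod p × ZMod p)),
    fun _ => inferInstanceAs (Finite (ZMod p × ZMod p))⟩

/-- `S` has nonempty fibres. [cite: MochizukiSemiAnbd2006, §3 p.37] -/
theorem twistCov_hasNonemptyFibres : (twistCov p).HasNonemptyFibres :=
  ⟨fun _ => ⟨((0 : ZMod p × ZMod p) : _)⟩, fun _ => ⟨((0 : ZMod p × ZMod p) : _)⟩⟩

/-- `S` splits itself at every point (all its stabilisers are the level-`1` box).
[cite: MochizukiSemiAnbd2006, Def 3.5(ii) p.37] -/
theorem twistCov_splitsAt (q : (twistCov p).Point) : (twistCov p).SplitsAt (twistCov p) q := by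
  rcases q with ⟨v, s⟩ | ⟨e, s⟩
  · intro x g hx
    change Iw p at g
    change ZMod p × ZMod p at x s
    have hx' : (PadicInt.toZMod g.a, PadicInt.toZMod g.s) + x = x := hx
    have h0 : (PadicInt.toZMod g.a, PadicInt.toZMod g.s) = 0 := add_eq_right.mp hx'
    show (PadicInt.toZMod g.a, PadicInt.toZMod g.s) + s = s
    rw [h0, zero_add]
  · intro x g hx
    change IwU p at g
    change ZMod p × ZMod p at x s
    have hx' : (PadicInt.toZMod (Iw.bHom 0 g).a, PadicInt.toZMod (Iw.bHom 0 g).s) + x = x := hx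
    have h0 : (PadicInt.toZMod (Iw.bHom 0 g).a, PadicInt.toZMod (Iw.bHom 0 g).s) = 0 :=
      add_eq_right.mp hx'
    show (PadicInt.toZMod (Iw.bHom 0 g).a, PadicInt.toZMod (Iw.bHom 0 g).s) + s = s
    rw [h0, zero_add]

/-- **`S` is tempered** (split by itself). [cite: MochizukiSemiAnbd2006, Def 3.5(ii) p.37] -/
theorem twistCov_isTempered : (twistCov p).IsTempered := fun _ =>
  ⟨twistCov p, twistCov_isFinite p, twistCov_hasNonemptyFibres p, fun q _ => twistCov_splitsAt p q⟩

/-! ## 3. Admissible families of conjugating elements for the identity morphism -/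

/-- `U` is commutative. [cite: MochizukiSemiAnbd2006, §2 p.23] -/
theorem IwU_mul_comm (x y : IwU p) : x * y = y * x := by
  ext; simp only [IwU.mul_s]; ring

/-- The 2-cell datum `θ_κ` for `loopGraphId`: `b₀(κ)` at the torus branch `(0, false)`, `1 = b₁(1)` at
the twisted branch `(0, true)`. [cite: MochizukiSemiAnbd2006, Rmk 2.4.2 p.26] -/
def twistElt (κ : IwU p) (b : (SemiGraph.bouquet.{0} 1).Branch) : Iw p :=
  Iw.bHom (coeff p b) (bif b.down.2 then 1 else κ)

/-- **`θ_κ` is an admissible family of conjugating elements for `loopGraphId p`** (`b_c(U)` is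
commutative, so `b_c(k)` centralises it). [cite: MochizukiSemiAnbd2006, Rmk 2.4.2 p.26] -/
def twistFamily (κ : IwU p) : (loopGraphId p).ConjugatorFamily where
  θ b _ _ := twistElt p κ b
  spec b v h x := by
    change twistElt p κ b * Iw.bHom (coeff p b) x * (twistElt p κ b)⁻¹ = Iw.bHom (coeff p b) x
    unfold twistElt
    rw [← map_mul, ← map_inv, ← map_mul, IwU_mul_comm p _ x, mul_inv_cancel_right]

/-! ## 4. No morphism between differently twisted pull-backs of `S` -/

/-- Equivariance of the vertex component of a morphism of pulled-back coverings, on elements.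
[cite: MochizukiSemiAnbd2006, §3 p.36] -/
private theorem fV_transl {κ κ' : IwU p}
    (f : ((loopGraphId p).covPullbackWith (twistFamily p κ)).obj (twistCov p) ⟶
      ((loopGraphId p).covPullbackWith (twistFamily p κ')).obj (twistCov p))
    (γ : Iw p) (y : ZMod p × ZMod p) :
    (f.fV PUnit.unit).hom.hom ((translObj p).obj.ρ γ y) =
      (translObj p).obj.ρ γ ((f.fV PUnit.unit).hom.hom y) :=
  BTempConnected.hom_ρ (f.fV PUnit.unit) γ y

/-- The gluing square of a morphism `F^*_{θ_κ} S → F^*_{θ_κ'} S` along the branch `(0, bb)`, evaluated at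
a point `x` of the edge fibre with `x.2 = 0`, second coordinate:
`(θ_κ' b).s̄ + (g x).2 = (θ_κ b).s̄ + (f x).2`. [cite: MochizukiSemiAnbd2006, §3 p.36] -/
private theorem square_snd {κ κ' : IwU p}
    (f : ((loopGraphId p).covPullbackWith (twistFamily p κ)).obj (twistCov p) ⟶
      ((loopGraphId p).covPullbackWith (twistFamily p κ')).obj (twistCov p))
    (bb : Bool) (x : ZMod p × ZMod p) (hx : x.2 = 0) :
    PadicInt.toZMod (twistElt p κ' ⟨(0, bb)⟩).s +
        ((f.fE ⟨0⟩).hom.hom x : ZMod p × ZMod p).2 =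
      PadicInt.toZMod (twistElt p κ ⟨(0, bb)⟩).s +
        ((f.fV PUnit.unit).hom.hom x : ZMod p × ZMod p).2 := by
  have hxs : shearEquiv p (PadicInt.toZMod (coeff p ⟨(0, bb)⟩)) x = x := by
    refine Prod.ext ?_ ?_
    · simp only [shearEquiv, Equiv.coe_fn_mk, hx, mul_zero, add_zero]
    · simp only [shearEquiv, Equiv.coe_fn_mk]
  let x' : ((((loopGraphId p).covPullbackWith (twistFamily p κ)).obj (twistCov p)).SE ⟨0⟩).obj.V := x
  have h' := congrArg (fun t => t.hom.hom x') (f.comm ⟨(0, bb)⟩ PUnit.unit rfl)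
  change ((((loopGraphId p).covPullbackWith (twistFamily p κ')).obj (twistCov p)).glue ⟨(0, bb)⟩
        PUnit.unit rfl).hom.hom.hom ((f.fE ⟨0⟩).hom.hom x) =
      ((BTemp.res ((loopGraph p).brHom ⟨(0, bb)⟩ PUnit.unit rfl)).map (f.fV PUnit.unit)).hom.hom
        (((((loopGraphId p).covPullbackWith (twistFamily p κ)).obj (twistCov p)).glue ⟨(0, bb)⟩
          PUnit.unit rfl).hom.hom.hom x) at h'
  rw [Hom.covPullbackWith_glue_apply, Hom.covPullbackWith_glue_apply] at h'
  change (translObj p).obj.ρ (twistElt p κ' ⟨(0, bb)⟩)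
      (shearEquiv p (PadicInt.toZMod (coeff p ⟨(0, bb)⟩)) ((f.fE ⟨0⟩).hom.hom x)) =
    (f.fV PUnit.unit).hom.hom ((translObj p).obj.ρ (twistElt p κ ⟨(0, bb)⟩)
      (shearEquiv p (PadicInt.toZMod (coeff p ⟨(0, bb)⟩)) x)) at h'
  rw [hxs, fV_transl, translObj_ρ, translObj_ρ] at h'
  have h2 := congrArg Prod.snd h'
  simp only [shearEquiv, Equiv.coe_fn_mk, Prod.snd_add] at h2
  exact h2

/-- **No morphism between differently twisted pull-backs of `S`**: a morphism
`F^*_{θ_κ} S → F^*_{θ_κ'} S` in `B^cov(𝒢₁)` forces `κ ≡ κ' (mod p)` (compare the squares along the two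
branches at the point `0`). [cite: MochizukiSemiAnbd2006, Rmk 2.4.2 p.26] -/
theorem toZMod_eq_of_hom (κ κ' : IwU p)
    (f : ((loopGraphId p).covPullbackWith (twistFamily p κ)).obj (twistCov p) ⟶
      ((loopGraphId p).covPullbackWith (twistFamily p κ')).obj (twistCov p)) :
    PadicInt.toZMod κ'.s = PadicInt.toZMod κ.s := by
  have h0 := square_snd p f false 0 rfl
  have h1 := square_snd p f true 0 rfl
  have e0 : (twistElt p κ' ⟨(0, false)⟩).s = κ'.s := by simp [twistElt]
  have e0' : (twistElt p κ ⟨(0, false)⟩).s = κ.s := by simp [twistElt]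
  have e1 : (twistElt p κ' ⟨(0, true)⟩).s = 0 := by simp [twistElt]
  have e1' : (twistElt p κ ⟨(0, true)⟩).s = 0 := by simp [twistElt]
  rw [e0, e0'] at h0
  rw [e1, e1', map_zero, zero_add, zero_add] at h1
  rw [h1] at h0
  exact add_right_cancel h0

/-! ## 5. From an isomorphism of chart pull-back functors to an isomorphism of pulled-back objects -/

/-- If the chart pull-back functors along two families `θ_A`, `θ_B` are isomorphic, then so are the
pulled-back coverings `F^*_{θ_A} S ≅ F^*_{θ_B} S` of every tempered `S` (conjugate back through the
chart equivalences). [cite: MochizukiSemiAnbd2006, Prop 3.6(iv) p.39] -/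
theorem nonempty_iso_of_chartPullbackWith_iso {𝒢' 𝒢 : ProfiniteSemiGraph.{u}} (F : Hom 𝒢' 𝒢)
    (θA θB : F.ConjugatorFamily) (c' : TemperedPiChart 𝒢') (c : TemperedPiChart 𝒢)
    (E : F.chartPullbackWith θA c' c ≅ F.chartPullbackWith θB c' c) (S : BTempCat 𝒢) :
    Nonempty ((F.covPullbackWith θA).obj S.obj ≅ (F.covPullbackWith θB).obj S.obj) := by
  let S' : BTempCat 𝒢 := c.equiv.inverse.obj (c.equiv.functor.obj S)
  let u : S ≅ S' := c.equiv.unitIso.app S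
  let VA : BTempCat 𝒢' := (F.btempPullbackWith θA).obj S'
  let VB : BTempCat 𝒢' := (F.btempPullbackWith θB).obj S'
  let e1 : c'.equiv.functor.obj VA ≅ c'.equiv.functor.obj VB := E.app (c.equiv.functor.obj S)
  let e2 : VA ≅ VB :=
    c'.equiv.unitIso.app VA ≪≫ c'.equiv.inverse.mapIso e1 ≪≫ (c'.equiv.unitIso.app VB).symm
  let e3 : (F.btempPullbackWith θA).obj S ≅ (F.btempPullbackWith θB).obj S :=
    (F.btempPullbackWith θA).mapIso u ≪≫ e2 ≪≫ ((F.btempPullbackWith θB).mapIso u).symm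
  exact ⟨(ObjectProperty.ι _).mapIso e3⟩

/-! ## 6. The refutation -/

/-- Under `InducesOfCompatible`, every twisted pull-back functor of `loopGraphId` through a chart is
isomorphic to the chosen one: `exists_inducedHom_with` produces `φ_κ` with `F^*_{θ_κ} ≅ B^temp(φ_κ)`,
compatible with `F` on verticial and edge homomorphisms, so `InducesOfCompatible` applies to `φ_κ`.
[cite: MochizukiSemiAnbd2006, Cor 3.9 p.43] -/
theorem chartPullbackWith_iso_chosen_of_inducesOfCompatible (H : InducesOfCompatible.{0})
    (c : TemperedPiChart (loopGraph p)) (κ : IwU p) :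
    Nonempty ((loopGraphId p).chartPullbackWith (twistFamily p κ) c c ≅
      (loopGraphId p).chartPullbackWith (loopGraphId p).chosenConjugators c c) := by
  obtain ⟨φ, ⟨i⟩, hV⟩ := (loopGraphId p).exists_inducedHom_with (twistFamily p κ) c c
  have hE : (loopGraphId p).CompatE c c φ := fun e ψ ψ' hψ hψ' =>
    (loopGraphId p).conj_of_chartPullbackWith_iso_edge (twistFamily p κ) c c φ ⟨i⟩ e ψ ψ' hψ hψ'
  have hind : (loopGraphId p).Induces c c φ :=
    H _ _ (loopGraph_cor39Hypotheses p) (loopGraph_cor39Hypotheses p) c c (loopGraphId p) φ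
      (loopGraphId_isLocallyOpen p) hV hE
  obtain ⟨j⟩ := hind
  exact ⟨i ≪≫ j.symm⟩

/-- **`InducesOfCompatible` is false** for every prime `p` on the witness `𝒢₁ = loopGraph p`: the
twisted pull-backs `F^*_{θ_1} S`, `F^*_{θ_κ} S` (`κ = 1 + p`) would be isomorphic, but there is not even
a morphism between them. [cite: MochizukiSemiAnbd2006, Cor 3.9 p.43] -/
theorem false_of_inducesOfCompatible (q : ℕ) [Fact q.Prime] (H : InducesOfCompatible.{0}) : False := by
  obtain ⟨c⟩ := ExistsTemperedPiChart_holds (loopGraph q) (loopGraph_prop36Hypotheses q)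
  obtain ⟨iA⟩ := chartPullbackWith_iso_chosen_of_inducesOfCompatible q H c 1
  obtain ⟨iB⟩ := chartPullbackWith_iso_chosen_of_inducesOfCompatible q H c ⟨1⟩
  obtain ⟨e⟩ := nonempty_iso_of_chartPullbackWith_iso (loopGraphId q) (twistFamily q 1)
    (twistFamily q ⟨1⟩) c c (iA ≪≫ iB.symm) ⟨twistCov q, twistCov_isTempered q⟩
  have h := toZMod_eq_of_hom q 1 ⟨1⟩ e.hom
  simp only [IwU.one_s, map_zero, map_one] at h
  exact one_ne_zero h

end IwahoriWitness

/-- **The chosen-conjugator reading of step (R3) of the proof of [SemiAnbd] Cor. 3.9 is refuted**: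
`¬ InducesOfCompatible` (universe `0`, where the witness `𝒢₁` lives). The existentially-twisted reading
`Hom.InducesUpToTwist` (landed) is the one the printed "well-defined up to conjugation" supports.
[cite: MochizukiSemiAnbd2006, Cor 3.9 p.43] -/
theorem ProfiniteSemiGraph.not_inducesOfCompatible :
    ¬ Literature.AnabelianGeometry.SemiGraphs.ProfiniteSemiGraph.InducesOfCompatible.{0} :=
  IwahoriWitness.false_of_inducesOfCompatible 2

end Literature.AnabelianGeometry.SemiGraphs

end
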